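import Summits.QuantumFields.YangMills.Theorems.LuscherReductionTwistedTraceScalingFloorScales
import HarnessLib

/-!
# The k = 0 FLOOR at polynomial scales, part 2: the mass near the vacuum and the Gaussian tail at the scales; elementary inequalities
# (lane A of S-BASE, crux `TwistedTraceScaling` stmt-QuantumFields-20203; design note `pub/ym-fleet/ym-luscher-20007-p1/COARSE-DESIGN.md` §18)

With `Λ_id(β) = (2π²)^{−|E|} e^{2β|E|} √(π/β)^{3|E|} e^{−6·toronZPE L (1/2) 0 0}` (`idealFloorLevel`: free link normalisation × the vacuum's harmonic zero-point factor):
* §1 elementary inequalities (`exp_neg_le_inv_one_add`, `rpow_neg_third_le_of_le`, `rpow_mul_exp_neg_le_eventually`; `e^{−2t} ≤ 1 − t` is the tree's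
  `Literature.NumberTheory.LFunctions.Nicolas.exp_neg_two_mul_le`);
* §2 `floorMass_pow_ge` — at `s = β^{−1/2}`, `γ = β^{7/10}`: `floorMass ≥ c·β^{−3|E|/2}` (`c = c(L, μ) > 0`);
* §3 `floorTail_eq` — `floorTail β ρ = e^{−βρ²/2}·2^{3|E|/2}·√(π/β)^{3|E|}`.
Part 3 (`…FloorAssembly`) assembles ★★★★ `vacuumFloorAt_ideal : ∃ K, VacuumFloorAt L Λ_id (K·β^{−1/10})` and the END-TO-END corollary COARSE-UPPER(L) ⇐ normalisation
comparison + INNER.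
HONEST FRAMING: real asymptotics for a stub lane of a child of the CONDITIONAL reduction route (femto rung R2b1); not infinite volume, not a gap, not Clay.

## References
* M. Lüscher, Nucl. Phys. B219 (1983) 233, §3. [Luscher1983]
* M. Lüscher, G. Münster, Nucl. Phys. B232 (1984) 445, §2. [LuscherMunster1984]
-/

set_option autoImplicit false

noncomputable section

open MeasureTheory Real Finset
open scoped BigOperators
open Literature.MathematicalPhysics.QuantumFieldTheory
open Literature.MathematicalPhysics.QuantumLattice

namespace Summit.QuantumFields.YangMills.Theorems.FemtoTransferGap

open TwoLattice TwoLattice.Toron TwoLattice.Cov TwoLattice.Stiff TwoLattice.Harm TwoLattice.GnChart TwoLattice.Flat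

variable {L : ℕ} [NeZero L]

/-! ## §1 Elementary inequalities -/

omit [NeZero L] in
/-- `e^{−x} ≤ (1 + x)⁻¹` for `x ≥ 0`. [folklore] -/
theorem exp_neg_le_inv_one_add {x : ℝ} (hx : 0 ≤ x) : Real.exp (-x) ≤ (1 + x)⁻¹ := by
  rw [Real.exp_neg, inv_le_inv₀ (Real.exp_pos x) (by linarith)]
  linarith [Real.add_one_le_exp x]

omit [NeZero L] in
/-- `β ≥ (c⁻¹)³` (`c > 0`, `β > 0`) ⇒ `β^{−1/3} ≤ c`. [folklore] -/
theorem rpow_neg_third_le_of_le {β c : ℝ} (hc : 0 < c) (hβ : (c⁻¹) ^ 3 ≤ β) : β ^ (-(1 / 3 : ℝ)) ≤ c := by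
  have hc3 : 0 < (c⁻¹) ^ 3 := by positivity
  have h1 : β ^ (-(1 / 3 : ℝ)) ≤ ((c⁻¹) ^ 3) ^ (-(1 / 3 : ℝ)) := Real.rpow_le_rpow_of_nonpos hc3 hβ (by norm_num)
  refine h1.trans (le_of_eq ?_)
  rw [show ((c⁻¹) ^ 3 : ℝ) = (c⁻¹) ^ (3 : ℝ) by rw [← Real.rpow_natCast]; norm_num, ← Real.rpow_mul (by positivity)]
  norm_num
  rw [Real.rpow_neg_one, inv_inv]

omit [NeZero L] in
/-- **Powers lose against stretched exponentials**: for `a > 0` and every `k`, eventually `β^k · e^{−β^a/2} ≤ e^{−4}` (`β ≥ 1`). [folklore] -/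
theorem rpow_mul_exp_neg_le_eventually {a : ℝ} (ha : 0 < a) (k : ℝ) :
    ∃ β0 : ℝ, ∀ β : ℝ, β0 ≤ β → 1 ≤ β ∧ β ^ k * Real.exp (-(β ^ a / 2)) ≤ Real.exp (-4) := by
  obtain ⟨β0, h⟩ := eventually_rpow_dominates (a := a) (b := 0) (k := k) (C := 0) ha ha
  refine ⟨β0, fun β hβ => ?_⟩
  obtain ⟨hβ1, h2⟩ := h β hβ
  refine ⟨hβ1, ?_⟩
  have hβ0 : 0 < β := by linarith
  rw [Real.rpow_zero, zero_add] at h2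
  rw [Real.rpow_def_of_pos hβ0, ← Real.exp_add, Real.exp_le_exp]
  nlinarith [h2]

/-! ## §2 The mass near the vacuum at `s = β^{−1/2}` -/

/-- ★ At `s = β^{−1/2}`, `γ = β^{7/10}`, `β ≥ 1` (`μ > 0`): `floorMass L β μ γ s ≥ c·β^{−3|E|/2}` with
`c = ((2π²)⁻¹/2)^{|E|}·e^{−2√(1/4+1/μ)(100N + 729945N_P)}·e^{−12|E|²} > 0`. [folklore] -/
theorem floorMass_pow_ge {μ : ℝ} (hμ : 0 < μ) : ∃ c : ℝ, 0 < c ∧ ∀ β : ℝ, 1 ≤ β →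
    c * (β ^ (-(1 / 2 : ℝ))) ^ (3 * Fintype.card (Edge 3 L)) ≤ floorMass L β μ (β ^ (7 / 10 : ℝ)) (β ^ (-(1 / 2 : ℝ))) := by
  set nE : ℕ := Fintype.card (Edge 3 L) with hnE
  set Cq : ℝ := 100 * Fintype.card (Plaquette 3 L × Fin 3) + 729945 * Fintype.card (Plaquette 3 L) with hCq
  set cg : ℝ := Real.sqrt (1 / 4 + 1 / μ) with hcg
  have hCq0 : 0 ≤ Cq := by positivity
  have hcg0 : 0 ≤ cg := Real.sqrt_nonneg _
  refine ⟨((2 * π ^ 2)⁻¹ / 2) ^ nE * (Real.exp (-(cg * Cq)) ^ 2 * Real.exp (-(6 * (nE : ℝ) ^ 2)) ^ 2), by positivity, fun β hβ => ?_⟩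
  have hβ0 : 0 < β := by linarith
  set s : ℝ := β ^ (-(1 / 2 : ℝ)) with hs
  have hs0 : 0 < s := Real.rpow_pos_of_pos hβ0 _
  have hs1 : s ≤ 1 := Real.rpow_le_one_of_one_le_of_nonpos hβ (by norm_num)
  have hs2 : β * s ^ 2 = 1 := by
    rw [hs, ← Real.rpow_natCast, ← Real.rpow_mul hβ0.le]; norm_num
    rw [Real.rpow_neg_one, mul_inv_cancel₀ hβ0.ne']
  have hγs : β ^ (7 / 10 : ℝ) * s ^ 2 ≤ 1 := by
    rw [hs, ← Real.rpow_natCast, ← Real.rpow_mul hβ0.le, ← Real.rpow_add hβ0]; norm_num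
    exact Real.rpow_le_one_of_one_le_of_nonpos hβ (by norm_num)
  rw [floorMass]
  -- the three factors
  have h1 : ((2 * π ^ 2)⁻¹ / 2) ^ nE * s ^ (3 * nE) ≤ ((2 * s) ^ 3 * ((2 * π ^ 2)⁻¹ * ((1 + 3 * s ^ 2)⁻¹) ^ 2)) ^ nE := by
    rw [pow_mul, ← mul_pow]
    refine pow_le_pow_left₀ (by positivity) ?_ nE
    have h3 : (1 / 4 : ℝ) ≤ (1 + 3 * s ^ 2)⁻¹ := by
      rw [le_inv_comm₀ (by norm_num) (by positivity)]; nlinarith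
    have h4 : (1 / 16 : ℝ) ≤ ((1 + 3 * s ^ 2)⁻¹) ^ 2 := by nlinarith [h3]
    have hπ : 0 < (2 * π ^ 2)⁻¹ := by positivity
    nlinarith [mul_le_mul_of_nonneg_left h4 hπ.le, pow_pos hs0 3, mul_nonneg (mul_nonneg (pow_pos hs0 3).le hπ.le) (sub_nonneg.2 h4)]
  have h2 : Real.exp (-(cg * Cq)) ≤ Real.exp (-(Real.sqrt ((β / 2) ^ 2 + 2 * (β / 2) * β / μ) * tubeSigma L s)) := by
    rw [Real.exp_le_exp, neg_le_neg_iff, sqrt_riccati_const hβ0.le hμ]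
    have h3 := tubeSigma_le_sq (L := L) hs0.le hs1
    calc β * cg * tubeSigma L s ≤ β * cg * (Cq * s ^ 2) := mul_le_mul_of_nonneg_left h3 (by positivity)
      _ = cg * Cq * (β * s ^ 2) := by ring
      _ = cg * Cq := by rw [hs2, mul_one]
  have h3 : Real.exp (-(6 * (nE : ℝ) ^ 2)) ≤ Real.exp (-(β ^ (7 / 10 : ℝ) * chartMove L (Real.sqrt 3 * s) ^ 2)) := by
    rw [Real.exp_le_exp, neg_le_neg_iff, chartMove]
    have h4 : (nE * (Real.sqrt 2 * (Real.sqrt 3 * s))) ^ 2 = 6 * (nE : ℝ) ^ 2 * s ^ 2 := by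
      rw [mul_pow, mul_pow, mul_pow, Real.sq_sqrt (by norm_num), Real.sq_sqrt (by norm_num)]; ring
    rw [← hnE, h4]
    calc β ^ (7 / 10 : ℝ) * (6 * (nE : ℝ) ^ 2 * s ^ 2) = 6 * (nE : ℝ) ^ 2 * (β ^ (7 / 10 : ℝ) * s ^ 2) := by ring
      _ ≤ 6 * (nE : ℝ) ^ 2 * 1 := mul_le_mul_of_nonneg_left hγs (by positivity)
      _ = _ := mul_one _
  have h2' := pow_le_pow_left₀ (Real.exp_pos _).le h2 2
  have h3' := pow_le_pow_left₀ (Real.exp_pos _).le h3 2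
  calc ((2 * π ^ 2)⁻¹ / 2) ^ nE * (Real.exp (-(cg * Cq)) ^ 2 * Real.exp (-(6 * (nE : ℝ) ^ 2)) ^ 2) * s ^ (3 * nE)
      = (((2 * π ^ 2)⁻¹ / 2) ^ nE * s ^ (3 * nE)) * (Real.exp (-(cg * Cq)) ^ 2 * Real.exp (-(6 * (nE : ℝ) ^ 2)) ^ 2) := by ring
    _ ≤ ((2 * s) ^ 3 * ((2 * π ^ 2)⁻¹ * ((1 + 3 * s ^ 2)⁻¹) ^ 2)) ^ nE *
        (Real.exp (-(Real.sqrt ((β / 2) ^ 2 + 2 * (β / 2) * β / μ) * tubeSigma L s)) ^ 2 *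
          Real.exp (-(β ^ (7 / 10 : ℝ) * chartMove L (Real.sqrt 3 * s) ^ 2)) ^ 2) :=
        mul_le_mul h1 (mul_le_mul h2' h3' (by positivity) (by positivity)) (by positivity) (by positivity)

/-! ## §3 The Gaussian tail in the normal-mode currency -/

/-- `floorTail L β ρ = e^{−βρ²/2}·2^{3|E|/2}·√(π/β)^{3|E|}` (`β > 0`). [folklore] -/
theorem floorTail_eq {β : ℝ} (hβ : 0 < β) (ρ : ℝ) :
    floorTail L β ρ = Real.exp (-(β * ρ ^ 2 / 2)) * ((2 : ℝ) ^ (((Fintype.card (Edge 3 L) * 3 : ℕ) : ℝ) / 2) *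
      Real.sqrt (Real.pi / β) ^ (Fintype.card (Edge 3 L) * 3)) := by
  rw [floorTail, finrank_linkSpace]
  congr 1
  have hq : 0 ≤ Real.pi / β := by positivity
  have h1 : Real.pi / (β / 2) = 2 * (Real.pi / β) := by field_simp
  rw [h1, Real.mul_rpow (by norm_num) hq]
  congr 1
  rw [Real.sqrt_eq_rpow, ← Real.rpow_natCast, ← Real.rpow_mul hq]
  congr 1
  ring

end Summit.QuantumFields.YangMills.Theorems.FemtoTransferGap

end
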